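import Summits.AtomisticToContinuum.HydrodynamicLimit.Theorems.AntiMazurCoboundariesCorrectorPressureDecayKiferCanonicalLocalLimitClosure
import Summits.AtomisticToContinuum.HydrodynamicLimit.Theorems.AntiMazurCoboundariesCorrectorPressureDecayKiferGibbsDensityCore
import Summits.AtomisticToContinuum.HydrodynamicLimit.Theorems.AntiMazurCoboundariesCorrectorPressureDecayKiferActivityBound

/-!
# The canonical local limit, V: DLR equations pass to setwise local limits (line `FirstLemma`, crux stmt-AtomisticToContinuum-14135)

Helper file of the registered stub `stub_canonicalLocalLimitIsGibbs : CanonicalLocalLimitIsGibbs` (identification half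
(E2) of Georgii's named fact, `…KiferCanonicalLocalLimit.lean`), namespace
`Summit.AtomisticToContinuum.HydrodynamicLimit.Theorems.KiferCompactification`. It proves the PASSAGE-TO-THE-LIMIT step of
every DLR route to (E2), for the grand-canonical hard-sphere specification `gibbsSpec` of
`Literature/Analysis/FluidPDE/InfiniteHardSphereFlow.lean`:

* `tendsto_lintegral_of_forall_tendsto_measure'`, `tendsto_lintegral_comp_windowRestrict` — setwise convergence of (window)
  laws gives convergence of the integrals of bounded measurable (local) functionals;
* `windowRestrict_superposeIn_windowRestrict`, `hardCoreIn_superposeIn_windowRestrict_iff`, `gibbsWeight_windowRestrict_eq`,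
  `gibbsSpec_windowRestrict_eq` — LOCALITY OF THE SPECIFICATION: on events of the configuration seen in a window `Λ'' ⊆ Λ'`,
  the kernel `Y ↦ γ_Λ(A | Y)` depends on the boundary condition `Y` only through its window `Λ'`, as soon as every position
  in `Λ` is at distance `≥ ε` from every position outside `Λ'` (the hard core does not reach across the collar);
* `gibbsWeight_univ_lt_top`, `gibbsSpec_univ_eq_one` — for `β > 0` and a window of finite volume the normalising weight is
  finite, so `γ_Λ(· | Y)` is a probability for EVERY boundary condition (no junk value of the quotient);
* `isHardSphereGibbs_of_tendsto_windowLaw` — **the set of `(ε, z, β, u)`-Gibbs states is closed under setwise local limits**,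
  in the strong form needed for finite-volume approximations: if probability laws `P k` satisfy the DLR equation in each
  bounded window EVENTUALLY in `k`, and their window laws converge setwise on every bounded measurable window to those of a
  probability law `G`, then `IsHardSphereGibbs ε z β u G` (DLR on local events by locality and the limit, then on all events
  by the π-λ theorem, `generateFrom_localEvents`), and its plain form `isHardSphereGibbs_of_tendsto_windowLaw_of_forall`
  (a setwise local limit of `(ε, z, β, u)`-Gibbs states is one); the convergence clause is literally that of
  `IsCanonicalLocalLimit` (`…KiferCanonicalLocalLimit.lean`), for an arbitrary approximating sequence.

What this does NOT give: (E2) itself. The x-averaged blown-up CANONICAL laws satisfy the canonical (fixed particle number), not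
the grand-canonical, DLR equations; their local limits are translation-invariant canonical Gibbs measures, and a
translation-invariant canonical Gibbs measure of prescribed density need not have a single activity (mixtures
`½ G_{z₁} + ½ G_{z₂}` do not) — the single activity of (E2) is the variational content of Georgii 1995 (Thm 3.3: local
accumulation points maximise the mean entropy at density `ρ`; Thm 3.4 with (3.12) and Remark 3.7: the maximisers are the
translation-invariant tempered Gibbs measures of ONE activity).

References: H.-O. Georgii, *Gibbs Measures and Phase Transitions* (2nd ed. 2011), Thm 4.17 (closedness of `𝒢(γ)` for
quasilocal specifications); H.-O. Georgii, J. Stat. Phys. 80 (1995) Thms 3.3–3.4, Remarks 3.6–3.7; C. Preston, *Random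
Fields*, LNM 534 (1976) §6.
-/

noncomputable section

open MeasureTheory Set Filter Topology Function Metric
open scoped ENNReal NNReal

namespace Summit.AtomisticToContinuum.HydrodynamicLimit.Theorems.KiferCompactification

open Literature.MathematicalPhysics.KineticTheory (V3)
open Literature.MathematicalPhysics.KineticTheory.PointProcess (windowLaw windowRestrict centredBox
  measurable_windowRestrict isProbabilityMeasure_windowLaw)
open Literature.Analysis.FluidPDE (IsHardSphereGibbs HardCoreIn superposeIn gibbsWeight gibbsSpec maxwellPhaseMeasure)
open Literature.Analysis.FunctionSpaces (PointConfig)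

/-! ## Setwise limits integrate bounded measurable functions -/

/-- **Setwise convergence of probability laws gives convergence of bounded `ℝ≥0∞`-integrals**: if `R k A → ν A` for every
measurable `A`, then `∫⁻ φ dR_k → ∫⁻ φ dν` for every measurable `φ ≤ C < ∞` (from the real-valued
`tendsto_integral_of_forall_tendsto_measure`). -/
theorem tendsto_lintegral_of_forall_tendsto_measure' {Ω : Type*} [MeasurableSpace Ω] {R : ℕ → Measure Ω}
    [∀ k, IsProbabilityMeasure (R k)] {ν : Measure Ω} [IsProbabilityMeasure ν]
    (h : ∀ A : Set Ω, MeasurableSet A → Tendsto (fun k => R k A) atTop (𝓝 (ν A)))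
    {φ : Ω → ℝ≥0∞} (hφ : Measurable φ) {C : ℝ≥0} (hC : ∀ x, φ x ≤ C) :
    Tendsto (fun k => ∫⁻ x, φ x ∂(R k)) atTop (𝓝 (∫⁻ x, φ x ∂ν)) := by
  have hfin : ∀ x, φ x ≠ ∞ := fun x => ne_top_of_le_ne_top ENNReal.coe_ne_top (hC x)
  set ψ : Ω → ℝ := fun x => (φ x).toReal with hψ
  have hψm : Measurable ψ := hφ.ennreal_toReal
  have hψC : ∀ x, |ψ x| ≤ C := fun x => by
    rw [abs_of_nonneg ENNReal.toReal_nonneg]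
    exact ENNReal.toReal_le_coe_of_le_coe (hC x)
  have hrepr : ∀ (ρ : Measure Ω), IsProbabilityMeasure ρ → ∫⁻ x, φ x ∂ρ = ENNReal.ofReal (∫ x, ψ x ∂ρ) := by
    intro ρ _
    rw [ofReal_integral_eq_lintegral_ofReal]
    · exact lintegral_congr fun x => (ENNReal.ofReal_toReal (hfin x)).symm
    · exact Integrable.of_bound hψm.aestronglyMeasurable C
        (ae_of_all _ fun x => by rw [Real.norm_eq_abs]; exact hψC x)
    · exact ae_of_all _ fun x => ENNReal.toReal_nonneg
  rw [hrepr ν inferInstance]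
  have hk : (fun k => ∫⁻ x, φ x ∂(R k)) = fun k => ENNReal.ofReal (∫ x, ψ x ∂(R k)) :=
    funext fun k => hrepr (R k) inferInstance
  rw [hk]
  exact (ENNReal.continuous_ofReal.tendsto _).comp (tendsto_integral_of_forall_tendsto_measure h hψm hψC)

/-- **Local functionals pass to setwise local limits**: if the window laws on `Λ` of the probability laws `P k` converge
setwise to the window law of `G`, then `∫⁻ g(ω_Λ) dP_k → ∫⁻ g(ω_Λ) dG` for every measurable `g ≤ C < ∞`. -/
theorem tendsto_lintegral_comp_windowRestrict {P : ℕ → Measure (PointConfig (V3 × V3))} [∀ k, IsProbabilityMeasure (P k)]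
    {G : Measure (PointConfig (V3 × V3))} [IsProbabilityMeasure G] {Λ : Set V3} (hΛ : MeasurableSet Λ)
    (hlim : ∀ A : Set (PointConfig (V3 × V3)), MeasurableSet A →
      Tendsto (fun k => windowLaw Λ (P k) A) atTop (𝓝 (windowLaw Λ G A)))
    {g : PointConfig (V3 × V3) → ℝ≥0∞} (hg : Measurable g) {C : ℝ≥0} (hC : ∀ ω, g ω ≤ C) :
    Tendsto (fun k => ∫⁻ ω, g (windowRestrict Λ ω) ∂(P k)) atTop (𝓝 (∫⁻ ω, g (windowRestrict Λ ω) ∂G)) := by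
  haveI : ∀ k, IsProbabilityMeasure (windowLaw Λ (P k)) := fun k => isProbabilityMeasure_windowLaw hΛ _
  haveI : IsProbabilityMeasure (windowLaw Λ G) := isProbabilityMeasure_windowLaw hΛ _
  have h := tendsto_lintegral_of_forall_tendsto_measure' hlim hg hC
  simp only [Literature.MathematicalPhysics.KineticTheory.PointProcess.windowLaw,
    lintegral_map hg (measurable_windowRestrict hΛ)] at h
  exact h

/-! ## Locality of the specification -/

/-- The window `Λ''` of a superposition in `Λ` sees the boundary condition only through any window `Λ' ⊇ Λ''`. -/
theorem windowRestrict_superposeIn_windowRestrict {Λ Λ' Λ'' : Set V3} (h : Λ'' ⊆ Λ') {k : ℕ} (x : Fin k → V3 × V3)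
    (Y : PointConfig (V3 × V3)) :
    windowRestrict Λ'' (superposeIn Λ x (windowRestrict Λ' Y)) = windowRestrict Λ'' (superposeIn Λ x Y) := by
  ext p
  simp only [mem_windowRestrict_iff, mem_superposeIn_iff]
  constructor
  · rintro ⟨hp | ⟨⟨hpY, -⟩, hpΛ⟩, hp''⟩
    · exact ⟨Or.inl hp, hp''⟩
    · exact ⟨Or.inr ⟨hpY, hpΛ⟩, hp''⟩
  · rintro ⟨hp | ⟨hpY, hpΛ⟩, hp''⟩
    · exact ⟨Or.inl hp, hp''⟩
    · exact ⟨Or.inr ⟨⟨hpY, h hp''⟩, hpΛ⟩, hp''⟩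

/-- The points of `superposeIn Λ x Y` lost when the boundary condition is cut down to its window `Λ'` are boundary
particles with position outside `Λ` and outside `Λ'`. -/
theorem fst_notMem_of_notMem_superposeIn_windowRestrict {Λ Λ' : Set V3} {k : ℕ} {x : Fin k → V3 × V3}
    {Y : PointConfig (V3 × V3)} {p : V3 × V3} (hp : p ∈ superposeIn Λ x Y)
    (hp' : p ∉ superposeIn Λ x (windowRestrict Λ' Y)) : p.1 ∉ Λ ∧ p.1 ∉ Λ' := by
  rcases (mem_superposeIn_iff Λ x Y p).1 hp with hpx | ⟨hpY, hpΛ⟩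
  · exact absurd ((mem_superposeIn_iff Λ x _ p).2 (Or.inl hpx)) hp'
  · refine ⟨hpΛ, fun hpΛ' => hp' ((mem_superposeIn_iff Λ x _ p).2 (Or.inr ⟨?_, hpΛ⟩))⟩
    exact (mem_windowRestrict_iff).2 ⟨hpY, hpΛ'⟩

/-- **The window hard core does not reach across the collar.** If every position in `Λ` is at distance `≥ ε` from every
position outside `Λ'`, the hard-core constraint in `Λ` of a superposition holds iff it holds after the boundary condition
is cut down to its window `Λ'`. -/
theorem hardCoreIn_superposeIn_windowRestrict_iff {ε : ℝ} {Λ Λ' : Set V3}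
    (hsep : ∀ a ∈ Λ, ∀ b, b ∉ Λ' → ε ≤ ‖a - b‖) {k : ℕ} (x : Fin k → V3 × V3) (Y : PointConfig (V3 × V3)) :
    HardCoreIn ε Λ (superposeIn Λ x (windowRestrict Λ' Y)) ↔ HardCoreIn ε Λ (superposeIn Λ x Y) := by
  have hsub : ∀ p ∈ superposeIn Λ x (windowRestrict Λ' Y), p ∈ superposeIn Λ x Y := by
    intro p hp
    rcases (mem_superposeIn_iff Λ x _ p).1 hp with hp | ⟨hpY, hpΛ⟩
    · exact Or.inl hp
    · exact Or.inr ⟨((mem_windowRestrict_iff).1 hpY).1, hpΛ⟩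
  refine ⟨fun h p hp q hq hpq hΛ => ?_, hardCoreIn_anti hsub⟩
  by_cases hp' : p ∈ superposeIn Λ x (windowRestrict Λ' Y)
  · by_cases hq' : q ∈ superposeIn Λ x (windowRestrict Λ' Y)
    · exact h p hp' q hq' hpq hΛ
    · have hq1 := fst_notMem_of_notMem_superposeIn_windowRestrict hq hq'
      exact hsep p.1 (hΛ.resolve_right hq1.1) q.1 hq1.2
  · have hp1 := fst_notMem_of_notMem_superposeIn_windowRestrict hp hp'
    rw [norm_sub_rev]
    exact hsep q.1 (hΛ.resolve_left hp1.1) p.1 hp1.2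

/-- **Locality of the grand-canonical weight**: on an event of the configuration seen in `Λ'' ⊆ Λ'`, with the collar
condition between `Λ` and `Λ'`, the weight depends on the boundary condition only through its window `Λ'`. -/
theorem gibbsWeight_windowRestrict_eq (ε z β : ℝ) (u : V3) {Λ Λ' Λ'' : Set V3} (h'' : Λ'' ⊆ Λ')
    (hsep : ∀ a ∈ Λ, ∀ b, b ∉ Λ' → ε ≤ ‖a - b‖) (Y : PointConfig (V3 × V3)) (B : Set (PointConfig (V3 × V3))) :
    gibbsWeight ε z β u Λ (windowRestrict Λ' Y) (windowRestrict Λ'' ⁻¹' B) =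
      gibbsWeight ε z β u Λ Y (windowRestrict Λ'' ⁻¹' B) := by
  unfold Literature.Analysis.FluidPDE.gibbsWeight
  refine tsum_congr fun k => ?_
  congr 1
  refine lintegral_congr fun x => ?_
  have hmem : superposeIn Λ x (windowRestrict Λ' Y) ∈ windowRestrict Λ'' ⁻¹' B ∩ {X | HardCoreIn ε Λ X} ↔
      superposeIn Λ x Y ∈ windowRestrict Λ'' ⁻¹' B ∩ {X | HardCoreIn ε Λ X} := by
    simp only [mem_inter_iff, mem_preimage, mem_setOf_eq, windowRestrict_superposeIn_windowRestrict h'' x Y,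
      hardCoreIn_superposeIn_windowRestrict_iff hsep x Y]
  by_cases hx : superposeIn Λ x Y ∈ windowRestrict Λ'' ⁻¹' B ∩ {X | HardCoreIn ε Λ X}
  · rw [indicator_of_mem hx, indicator_of_mem (hmem.2 hx)]
    rfl
  · rw [indicator_of_notMem hx, indicator_of_notMem (mt hmem.1 hx)]

/-- Locality of the normalising weight (the case `B = univ`). -/
theorem gibbsWeight_windowRestrict_univ (ε z β : ℝ) (u : V3) {Λ Λ' : Set V3}
    (hsep : ∀ a ∈ Λ, ∀ b, b ∉ Λ' → ε ≤ ‖a - b‖) (Y : PointConfig (V3 × V3)) :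
    gibbsWeight ε z β u Λ (windowRestrict Λ' Y) univ = gibbsWeight ε z β u Λ Y univ := by
  have h := gibbsWeight_windowRestrict_eq ε z β u (Subset.refl Λ') hsep Y univ
  rwa [preimage_univ] at h

/-- **Locality of the specification** `γ_Λ(A | Y) = γ_Λ(A | Y_{Λ'})` on events `A` of the configuration seen in
`Λ'' ⊆ Λ'`, under the collar condition between `Λ` and `Λ'`. -/
theorem gibbsSpec_windowRestrict_eq (ε z β : ℝ) (u : V3) {Λ Λ' Λ'' : Set V3} (h'' : Λ'' ⊆ Λ')
    (hsep : ∀ a ∈ Λ, ∀ b, b ∉ Λ' → ε ≤ ‖a - b‖) (Y : PointConfig (V3 × V3)) (B : Set (PointConfig (V3 × V3))) :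
    gibbsSpec ε z β u Λ (windowRestrict Λ' Y) (windowRestrict Λ'' ⁻¹' B) =
      gibbsSpec ε z β u Λ Y (windowRestrict Λ'' ⁻¹' B) := by
  unfold Literature.Analysis.FluidPDE.gibbsSpec
  rw [gibbsWeight_windowRestrict_eq ε z β u h'' hsep Y B, gibbsWeight_windowRestrict_univ ε z β u hsep Y]

/-! ## The specification is a probability for every boundary condition -/

/-- For a window of finite volume and `β > 0` the normalising weight is finite:
`w(Y) ≤ ∑ₖ (|z| vol Λ)ᵏ / k! = e^{|z| vol Λ}`. -/
theorem gibbsWeight_univ_lt_top (ε z : ℝ) {β : ℝ} (hβ : 0 < β) (u : V3) {Λ : Set V3} (hΛ : MeasurableSet Λ)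
    (hΛv : volume Λ ≠ ∞) (Y : PointConfig (V3 × V3)) : gibbsWeight ε z β u Λ Y univ < ∞ := by
  haveI := sigmaFinite_maxwellPhaseMeasure β u Λ
  set r : ℝ := (volume Λ).toReal with hr
  have hr0 : 0 ≤ r := ENNReal.toReal_nonneg
  have hle : ∀ k : ℕ, ENNReal.ofReal (z ^ k / (Nat.factorial k)) *
      (Measure.pi fun _ : Fin k => maxwellPhaseMeasure β u Λ) {x | HardCoreIn ε Λ (superposeIn Λ x Y)} ≤
      ENNReal.ofReal ((|z| * r) ^ k / (Nat.factorial k)) := fun k => by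
    have h1 : ENNReal.ofReal (z ^ k / (Nat.factorial k)) ≤ ENNReal.ofReal (|z| ^ k / (Nat.factorial k)) :=
      ENNReal.ofReal_le_ofReal (div_le_div_of_nonneg_right ((le_abs_self _).trans_eq (abs_pow z k)) (by positivity))
    have h2 : (Measure.pi fun _ : Fin k => maxwellPhaseMeasure β u Λ) {x | HardCoreIn ε Λ (superposeIn Λ x Y)} ≤
        (Measure.pi fun _ : Fin k => maxwellPhaseMeasure β u Λ) univ := measure_mono (subset_univ _)
    calc ENNReal.ofReal (z ^ k / (Nat.factorial k)) *
          (Measure.pi fun _ : Fin k => maxwellPhaseMeasure β u Λ) {x | HardCoreIn ε Λ (superposeIn Λ x Y)}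
        ≤ ENNReal.ofReal (|z| ^ k / (Nat.factorial k)) * (Measure.pi fun _ : Fin k => maxwellPhaseMeasure β u Λ) univ :=
          mul_le_mul' h1 h2
      _ = ENNReal.ofReal (|z| ^ k / (Nat.factorial k)) * ENNReal.ofReal (r ^ k) := by
          rw [Measure.pi_univ, Finset.prod_const, Finset.card_univ, Fintype.card_fin, maxwellPhaseMeasure_univ hβ,
            hr, ENNReal.ofReal_pow ENNReal.toReal_nonneg, ENNReal.ofReal_toReal hΛv]
      _ = ENNReal.ofReal ((|z| * r) ^ k / (Nat.factorial k)) := by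
          rw [← ENNReal.ofReal_mul (by positivity), mul_pow, div_mul_eq_mul_div]
  rw [gibbsWeight_univ_eq_tsum ε z β u hΛ Y]
  refine lt_of_le_of_lt (ENNReal.tsum_le_tsum hle) ?_
  rw [← ENNReal.ofReal_tsum_of_nonneg (fun k => by positivity) (Real.summable_pow_div_factorial _)]
  exact ENNReal.ofReal_lt_top

/-- Hence `γ_Λ(univ | Y) = 1` for EVERY boundary condition `Y` (window of finite volume, `β > 0`). -/
theorem gibbsSpec_univ_eq_one (ε z : ℝ) {β : ℝ} (hβ : 0 < β) (u : V3) {Λ : Set V3} (hΛ : MeasurableSet Λ)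
    (hΛv : volume Λ ≠ ∞) (Y : PointConfig (V3 × V3)) : gibbsSpec ε z β u Λ Y univ = 1 :=
  ENNReal.div_self (gibbsWeight_univ_ne_zero ε z β u Λ Y) (gibbsWeight_univ_lt_top ε z hβ u hΛ hΛv Y).ne

/-- The specification never exceeds `1`. -/
theorem gibbsSpec_le_one (ε z β : ℝ) (u : V3) (Λ : Set V3) (Y : PointConfig (V3 × V3)) (A : Set (PointConfig (V3 × V3))) :
    gibbsSpec ε z β u Λ Y A ≤ 1 :=
  (ENNReal.div_le_div_right (gibbsWeight_mono ε z β u Λ Y (subset_univ A)) _).trans ENNReal.div_self_le_one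

/-! ## Geometry of the collar: bounded windows sit well inside large centred cubes -/

/-- A point outside the centred cube `Λ_m = [-(m+1), m+1)³` has norm `≥ m + 1`. -/
theorem le_norm_of_notMem_centredBox {m : ℕ} {b : V3} (hb : b ∉ centredBox (d := Fin 3) m) : (m : ℝ) + 1 ≤ ‖b‖ := by
  simp only [Literature.MathematicalPhysics.KineticTheory.PointProcess.centredBox, mem_setOf_eq, mem_Ico, not_forall,
    not_and_or, not_le, not_lt] at hb
  obtain ⟨i, hi⟩ := hb
  have h1 : (m : ℝ) + 1 ≤ |b i| := by
    rcases hi with hi | hi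
    · have : b i < 0 := by linarith [m.cast_nonneg (α := ℝ)]
      rw [abs_of_neg this]; linarith
    · exact hi.trans (le_abs_self _)
  calc (m : ℝ) + 1 ≤ |b i| := h1
    _ = ‖b i‖ := (Real.norm_eq_abs _).symm
    _ ≤ ‖b‖ := PiLp.norm_apply_le b i

/-- **Collar lemma.** A bounded window `Λ` and the complement of a large centred cube are `ε`-separated: if `Λ ⊆ B(0, R)`
and `R + ε ≤ m + 1` then every position in `Λ` is at distance `≥ ε` from every position outside `Λ_m`. -/
theorem sep_of_subset_ball {ε R : ℝ} {Λ : Set V3} (hΛ : Λ ⊆ closedBall (0 : V3) R) {m : ℕ} (hm : R + ε ≤ (m : ℝ) + 1) :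
    ∀ a ∈ Λ, ∀ b, b ∉ centredBox (d := Fin 3) m → ε ≤ ‖a - b‖ := by
  intro a ha b hb
  have ha' : ‖a‖ ≤ R := mem_closedBall_zero_iff.1 (hΛ ha)
  have hb' := le_norm_of_notMem_centredBox hb
  have htri : ‖b‖ ≤ ‖a - b‖ + ‖a‖ := by
    calc ‖b‖ = ‖a - (a - b)‖ := by rw [sub_sub_cancel]
      _ ≤ ‖a‖ + ‖a - b‖ := norm_sub_le _ _
      _ = ‖a - b‖ + ‖a‖ := add_comm _ _
  linarith

/-! ## Closedness of the Gibbs class under setwise local limits -/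

/-- **DLR on one local event passes to the limit.** Probability laws `P k` whose window laws converge setwise to those of
`G` on the bounded measurable windows `Λ'` and `Λ''`, and which satisfy the DLR equation in `Λ` on the event
`A = {ω | ω_{Λ''} ∈ B}` eventually, pass the equation on `A` to `G` — provided `Λ'' ⊆ Λ'` and the collar condition holds. -/
theorem dlr_local_of_tendsto {ε z β : ℝ} {u : V3} {P : ℕ → Measure (PointConfig (V3 × V3))} [∀ k, IsProbabilityMeasure (P k)]
    {G : Measure (PointConfig (V3 × V3))} [IsProbabilityMeasure G] {Λ Λ' Λ'' : Set V3} (hΛ : MeasurableSet Λ)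
    (hΛ' : MeasurableSet Λ') (hΛ'' : MeasurableSet Λ'') (h'' : Λ'' ⊆ Λ') (hsep : ∀ a ∈ Λ, ∀ b, b ∉ Λ' → ε ≤ ‖a - b‖)
    (hlim' : ∀ A : Set (PointConfig (V3 × V3)), MeasurableSet A →
      Tendsto (fun k => windowLaw Λ' (P k) A) atTop (𝓝 (windowLaw Λ' G A)))
    (hlim'' : ∀ A : Set (PointConfig (V3 × V3)), MeasurableSet A →
      Tendsto (fun k => windowLaw Λ'' (P k) A) atTop (𝓝 (windowLaw Λ'' G A)))
    {B : Set (PointConfig (V3 × V3))} (hB : MeasurableSet B)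
    (hDLR : ∀ᶠ k in atTop, P k (windowRestrict Λ'' ⁻¹' B) =
      ∫⁻ Y, gibbsSpec ε z β u Λ Y (windowRestrict Λ'' ⁻¹' B) ∂(P k)) :
    G (windowRestrict Λ'' ⁻¹' B) = ∫⁻ Y, gibbsSpec ε z β u Λ Y (windowRestrict Λ'' ⁻¹' B) ∂G := by
  set A := windowRestrict Λ'' ⁻¹' B with hA
  have hAm : MeasurableSet A := measurable_windowRestrict hΛ'' hB
  -- left-hand sides: `P k A = (P k)_{Λ''} B → G_{Λ''} B = G A`
  have hL : Tendsto (fun k => P k A) atTop (𝓝 (G A)) := by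
    have h := hlim'' B hB
    simp only [Literature.MathematicalPhysics.KineticTheory.PointProcess.windowLaw,
      Measure.map_apply (measurable_windowRestrict hΛ'') hB] at h
    exact h
  -- right-hand sides: the kernel is a bounded measurable function of the window `Λ'`
  set g : PointConfig (V3 × V3) → ℝ≥0∞ := fun W => gibbsSpec ε z β u Λ W A with hg
  have hgm : Measurable g := measurable_gibbsSpec ε z β u hΛ hAm
  have hg1 : ∀ W, g W ≤ (1 : ℝ≥0) := fun W => by simpa [hg] using gibbsSpec_le_one ε z β u Λ W A
  have hloc : ∀ Y, gibbsSpec ε z β u Λ Y A = g (windowRestrict Λ' Y) := fun Y =>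
    (gibbsSpec_windowRestrict_eq ε z β u h'' hsep Y B).symm
  have hR : Tendsto (fun k => ∫⁻ Y, gibbsSpec ε z β u Λ Y A ∂(P k)) atTop (𝓝 (∫⁻ Y, gibbsSpec ε z β u Λ Y A ∂G)) := by
    simp_rw [hloc]
    exact tendsto_lintegral_comp_windowRestrict hΛ' hlim' hgm hg1
  exact tendsto_nhds_unique (hL.congr' hDLR) hR

/-- **The Gibbs class `𝒢(ε, z, β, u)` is closed under setwise local limits** (strong form). Let `β > 0`. If probability laws
`P k` satisfy, for every bounded measurable window `Λ` and measurable event `A`, the DLR equation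
`P k A = ∫⁻ γ_Λ(A | Y) dP_k(Y)` for all large `k`, and their window laws converge setwise on every bounded measurable
window to those of a probability law `G`, then `G` is an `(ε, z, β, u)`-Gibbs state of the hard-sphere gas. -/
theorem isHardSphereGibbs_of_tendsto_windowLaw {ε z β : ℝ} {u : V3} (hβ : 0 < β)
    {P : ℕ → Measure (PointConfig (V3 × V3))} [∀ k, IsProbabilityMeasure (P k)]
    {G : Measure (PointConfig (V3 × V3))} [IsProbabilityMeasure G]
    (hDLR : ∀ Λ : Set V3, MeasurableSet Λ → Bornology.IsBounded Λ → ∀ A : Set (PointConfig (V3 × V3)), MeasurableSet A →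
      ∀ᶠ k in atTop, P k A = ∫⁻ Y, gibbsSpec ε z β u Λ Y A ∂(P k))
    (hlim : ∀ Λ : Set V3, MeasurableSet Λ → Bornology.IsBounded Λ → ∀ A : Set (PointConfig (V3 × V3)), MeasurableSet A →
      Tendsto (fun k => windowLaw Λ (P k) A) atTop (𝓝 (windowLaw Λ G A))) :
    IsHardSphereGibbs ε z β u G := by
  refine ⟨inferInstance, fun Λ hΛ hΛb A hA => ?_⟩
  -- a centred cube `Λ_{m₀}` whose complement is `ε`-separated from `Λ`
  obtain ⟨R, hR⟩ := hΛb.subset_closedBall (0 : V3)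
  obtain ⟨m₀, hm₀⟩ := exists_nat_ge (R + ε)
  have hsep : ∀ m : ℕ, m₀ ≤ m → ∀ a ∈ Λ, ∀ b, b ∉ centredBox (d := Fin 3) m → ε ≤ ‖a - b‖ := fun m hm =>
    sep_of_subset_ball hR (hm₀.trans (by exact_mod_cast Nat.le_succ_of_le hm))
  have hΛv : volume Λ ≠ ∞ := (lt_of_le_of_lt (measure_mono hR) measure_closedBall_lt_top).ne
  -- the right-hand side as a measure
  set ν : Measure (PointConfig (V3 × V3)) := G.bind (gibbsSpecMeasure ε z β u Λ) with hν
  have hνA : ∀ A' : Set (PointConfig (V3 × V3)), MeasurableSet A' → ν A' = ∫⁻ Y, gibbsSpec ε z β u Λ Y A' ∂G := by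
    intro A' hA'
    rw [hν, Measure.bind_apply hA' (measurable_gibbsSpecMeasure ε z β u hΛ).aemeasurable]
    simp_rw [gibbsSpecMeasure_apply ε z β u hΛ _ hA']
  rw [← hνA A hA]
  revert A
  change ∀ A, MeasurableSet A → G A = ν A
  suffices hGν : G = ν from fun A _ => by rw [← hGν]
  have huniv : G univ = ν univ := by
    rw [hνA univ MeasurableSet.univ]
    simp_rw [gibbsSpec_univ_eq_one ε z hβ u hΛ hΛv]
    rw [lintegral_const, one_mul]
  refine ext_of_generate_finite _ generateFrom_localEvents.symm isPiSystem_localEvents (fun A' hA' => ?_) huniv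
  obtain ⟨n, B, hB, rfl⟩ := hA'
  -- view the `Λ_n`-local event as a `Λ_m`-local event, `m = max n m₀`
  set m := max n m₀ with hm
  have hview : windowRestrict (centredBox (d := Fin 3) n) ⁻¹' B =
      windowRestrict (centredBox (d := Fin 3) m) ⁻¹' (windowRestrict (centredBox (d := Fin 3) n) ⁻¹' B) := by
    ext ω
    rw [mem_preimage, mem_preimage, mem_preimage, windowRestrict_windowRestrict (centredBox_mono (le_max_left n m₀)) ω]
  have hB' : MeasurableSet (windowRestrict (centredBox (d := Fin 3) n) ⁻¹' B) :=
    measurable_windowRestrict (measurableSet_centredBox_fin3 n) hB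
  rw [hview, hνA _ (measurable_windowRestrict (measurableSet_centredBox_fin3 m) hB')]
  exact dlr_local_of_tendsto hΛ (measurableSet_centredBox_fin3 m) (measurableSet_centredBox_fin3 m) Subset.rfl
    (hsep m (le_max_right n m₀))
    (hlim _ (measurableSet_centredBox_fin3 m) (isBounded_centredBox m))
    (hlim _ (measurableSet_centredBox_fin3 m) (isBounded_centredBox m)) hB'
    (hDLR Λ hΛ hΛb _ (measurable_windowRestrict (measurableSet_centredBox_fin3 m) hB'))

/-- **Closedness of the Gibbs class, plain form**: a setwise local limit of `(ε, z, β, u)`-Gibbs states is an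
`(ε, z, β, u)`-Gibbs state (`β > 0`). -/
theorem isHardSphereGibbs_of_tendsto_windowLaw_of_forall {ε z β : ℝ} {u : V3} (hβ : 0 < β)
    {P : ℕ → Measure (PointConfig (V3 × V3))} (hP : ∀ k, IsHardSphereGibbs ε z β u (P k))
    {G : Measure (PointConfig (V3 × V3))} [IsProbabilityMeasure G]
    (hlim : ∀ Λ : Set V3, MeasurableSet Λ → Bornology.IsBounded Λ → ∀ A : Set (PointConfig (V3 × V3)), MeasurableSet A →
      Tendsto (fun k => windowLaw Λ (P k) A) atTop (𝓝 (windowLaw Λ G A))) :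
    IsHardSphereGibbs ε z β u G := by
  haveI : ∀ k, IsProbabilityMeasure (P k) := fun k => (hP k).1
  exact isHardSphereGibbs_of_tendsto_windowLaw hβ
    (fun Λ hΛ hΛb A hA => Eventually.of_forall fun k => (hP k).2 Λ hΛ hΛb A hA) hlim

end Summit.AtomisticToContinuum.HydrodynamicLimit.Theorems.KiferCompactification

end
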